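import Summits.QuantumFields.YangMills.Theorems.SandwichVariancePinchingFloorWhitenedSmooth
import Mathlib.Analysis.Calculus.BumpFunction.Convolution
import Mathlib.Analysis.Calculus.ContDiff.Convolution

/-!
# Route `SandwichVariancePinching` — crux `QuadraticVarianceFloor` (stmt-QuantumFields-28260):
# **MOLLIFICATION** — the variance floor in the whitened frame for a CONTINUOUS potential

The crux quantifies over continuous potentials `A` with the second-DIFFERENCE sandwich, while the affine-score
integration by parts (`…FloorWhitenedSmooth.floorWhitened_of_contDiff`) needs `A ∈ C²`.  Bridge (sorry-free):
§1 smoothing by normed bumps `A_φ := φ̄ ⋆ A` — `A_φ ∈ C^∞` (`contDiff_moll`); the sandwich is LINEAR in `A`,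
hence inherited by `A_φ` (`sandwich_moll`); a quadratic lower bound passes to `A_φ` uniformly in the support
radius `≤ 1` (`quadratic_lower_moll`); `A_φ → A` pointwise (`tendsto_moll`); hence the Gibbs moments of
polynomial weights converge (`tendsto_integral_moll`, dominated convergence).  §2 `floorWhitened`: mollify,
RECENTRE by the mean `m_k` (a translation: sandwich kept, centring restored), apply the smooth floor to the
observable `(H, b + 2Hm_k)` — its variance under the recentred weight is the variance of `q` under `e^{−A_k}`
— and pass to the limit (`m_k → 0` by the centring of `A`).  With `…FloorWhitening` this gives the crux BY NAME.

HONEST SCOPE.  Free-hands work of the LEAD seat of crux stmt-QuantumFields-22884 (cell ym-idea-1) on planner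
ym-idea-3's draft-by-design sub-line; proves the whitened floor only — not by itself `QuadraticVarianceFloor`,
nor `QuadraticVarianceCeiling`, `LogConcaveChart.QuadraticCovarianceComparison` (26240), rung R2a or any summit
statement; the Yang–Mills mass gap is NOT proved by any of this.
-/

noncomputable section

namespace Summit.QuantumFields.YangMills.Theorems.SandwichVariancePinching

open MeasureTheory Real Filter Topology ContinuousLinearMap
open scoped Convolution

variable {n : ℕ}

/-- The mollified potential is an average of translates: `(φ̄ ⋆ A)(x) = ∫ φ̄(t) A(x − t) dt`.
[folklore] -/
theorem moll_apply (φ : ContDiffBump (0 : Fin n → ℝ)) (A : (Fin n → ℝ) → ℝ) (x : Fin n → ℝ) :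
    (φ.normed volume ⋆[lsmul ℝ ℝ, volume] A) x = ∫ t, φ.normed volume t * A (x - t) := by
  rw [convolution_lsmul]; rfl

/-- Integrability of `t ↦ φ̄(t)·A(x − t)` for continuous `A`. [folklore] -/
theorem integrable_normed_mul_comp_sub (φ : ContDiffBump (0 : Fin n → ℝ)) {A : (Fin n → ℝ) → ℝ}
    (hA : Continuous A) (x : Fin n → ℝ) :
    Integrable fun t => φ.normed volume t * A (x - t) := by
  refine Continuous.integrable_of_hasCompactSupport (φ.continuous_normed.mul (hA.comp
    (continuous_const.sub continuous_id))) ?_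
  exact φ.hasCompactSupport_normed.mul_right

/-- The mollified potential is `C²` (indeed smooth). [folklore] -/
theorem contDiff_moll (φ : ContDiffBump (0 : Fin n → ℝ)) {A : (Fin n → ℝ) → ℝ} (hA : Continuous A) :
    ContDiff ℝ 2 (φ.normed volume ⋆[lsmul ℝ ℝ, volume] A) :=
  φ.hasCompactSupport_normed.contDiff_convolution_left (lsmul ℝ ℝ) φ.contDiff_normed
    (hA.locallyIntegrable)

/-- LOWER TRANSFER: if `L ≤ A(x − t)` for all `t` in the support ball of `φ̄`, then `L ≤ (φ̄ ⋆ A)(x)`.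
[folklore] -/
theorem le_moll_of_forall_ball (φ : ContDiffBump (0 : Fin n → ℝ)) {A : (Fin n → ℝ) → ℝ}
    (hA : Continuous A) (x : Fin n → ℝ) {L : ℝ}
    (hL : ∀ t : Fin n → ℝ, ‖t‖ < φ.rOut → L ≤ A (x - t)) :
    L ≤ (φ.normed volume ⋆[lsmul ℝ ℝ, volume] A) x := by
  rw [moll_apply]
  have h1 : ∫ t, φ.normed volume t * L = L := by
    rw [integral_mul_const, φ.integral_normed, one_mul]
  rw [← h1]
  refine integral_mono ((φ.continuous_normed.integrable_of_hasCompactSupport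
    φ.hasCompactSupport_normed).mul_const L) (integrable_normed_mul_comp_sub φ hA x) fun t => ?_
  by_cases ht : ‖t‖ < φ.rOut
  · exact mul_le_mul_of_nonneg_left (hL t ht) (φ.nonneg_normed t)
  · have h0 : φ.normed volume t = 0 := by
      have : t ∉ Function.support (φ.normed volume) := by
        rw [φ.support_normed_eq]; simpa using ht
      simpa [Function.mem_support] using this
    simp [h0]

/-- UPPER TRANSFER: if `A(x − t) ≤ U` on the support ball, then `(φ̄ ⋆ A)(x) ≤ U`. [folklore] -/
theorem moll_le_of_forall_ball (φ : ContDiffBump (0 : Fin n → ℝ)) {A : (Fin n → ℝ) → ℝ}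
    (hA : Continuous A) (x : Fin n → ℝ) {U : ℝ}
    (hU : ∀ t : Fin n → ℝ, ‖t‖ < φ.rOut → A (x - t) ≤ U) :
    (φ.normed volume ⋆[lsmul ℝ ℝ, volume] A) x ≤ U := by
  rw [moll_apply]
  have h1 : ∫ t, φ.normed volume t * U = U := by
    rw [integral_mul_const, φ.integral_normed, one_mul]
  rw [← h1]
  refine integral_mono (integrable_normed_mul_comp_sub φ hA x) ((φ.continuous_normed.integrable_of_hasCompactSupport
    φ.hasCompactSupport_normed).mul_const U) fun t => ?_
  by_cases ht : ‖t‖ < φ.rOut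
  · exact mul_le_mul_of_nonneg_left (hU t ht) (φ.nonneg_normed t)
  · have h0 : φ.normed volume t = 0 := by
      have : t ∉ Function.support (φ.normed volume) := by
        rw [φ.support_normed_eq]; simpa using ht
      simpa [Function.mem_support] using this
    simp [h0]

/-- **MOLLIFICATION PRESERVES THE SANDWICH**: the second differences of `φ̄ ⋆ A` obey the same
two-sided bounds as those of `A` (the sandwich is linear in `A`; `φ̄ ≥ 0`, `∫φ̄ = 1`). [folklore] -/
theorem sandwich_moll (φ : ContDiffBump (0 : Fin n → ℝ)) {A : (Fin n → ℝ) → ℝ} (hA : Continuous A)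
    {δ : ℝ}
    (hsw : ∀ x h : Fin n → ℝ, (1 - δ) * (h ⬝ᵥ h) ≤ A (x + h) + A (x - h) - 2 * A x ∧
      A (x + h) + A (x - h) - 2 * A x ≤ (1 + δ) * (h ⬝ᵥ h)) (x h : Fin n → ℝ) :
    (1 - δ) * (h ⬝ᵥ h) ≤ (φ.normed volume ⋆[lsmul ℝ ℝ, volume] A) (x + h) +
        (φ.normed volume ⋆[lsmul ℝ ℝ, volume] A) (x - h) - 2 * (φ.normed volume ⋆[lsmul ℝ ℝ, volume] A) x ∧
      (φ.normed volume ⋆[lsmul ℝ ℝ, volume] A) (x + h) +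
        (φ.normed volume ⋆[lsmul ℝ ℝ, volume] A) (x - h) - 2 * (φ.normed volume ⋆[lsmul ℝ ℝ, volume] A) x
        ≤ (1 + δ) * (h ⬝ᵥ h) := by
  -- the second difference of the mollification is the mollification of the second difference
  set S : (Fin n → ℝ) → ℝ := fun y => A (y + h) + A (y - h) - 2 * A y with hS
  have hSc : Continuous S := ((hA.comp (continuous_id.add continuous_const)).add
    (hA.comp (continuous_id.sub continuous_const))).sub (continuous_const.mul hA)
  have hSx : (φ.normed volume ⋆[lsmul ℝ ℝ, volume] A) (x + h) +
      (φ.normed volume ⋆[lsmul ℝ ℝ, volume] A) (x - h) - 2 * (φ.normed volume ⋆[lsmul ℝ ℝ, volume] A) x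
      = (φ.normed volume ⋆[lsmul ℝ ℝ, volume] S) x := by
    have h1 := integrable_normed_mul_comp_sub φ hA (x + h)
    have h2 := integrable_normed_mul_comp_sub φ hA (x - h)
    have h3 := integrable_normed_mul_comp_sub φ hA x
    have h12 : Integrable fun t => φ.normed volume t * A (x + h - t) + φ.normed volume t * A (x - h - t) :=
      h1.add h2
    have h3' : Integrable fun t => 2 * (φ.normed volume t * A (x - t)) := h3.const_mul 2
    rw [moll_apply, moll_apply, moll_apply, moll_apply, ← integral_add h1 h2, ← integral_const_mul,
      ← integral_sub h12 h3']
    congr 1; funext t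
    simp only [hS]
    rw [show x + h - t = x - t + h by abel, show x - h - t = x - t - h by abel]
    ring
  rw [hSx]
  constructor
  · exact le_moll_of_forall_ball φ hSc x fun t _ => (hsw (x - t) h).1
  · exact moll_le_of_forall_ball φ hSc x fun t _ => (hsw (x - t) h).2

/-- **UNIFORM QUADRATIC LOWER BOUND for the mollifications** with support radius `≤ 1`:
if `−C(1+‖x‖) + κ‖x‖² ≤ A(x)` (`C, κ ≥ 0`) then `−(2C+2κ)(1+‖x‖) + κ‖x‖² ≤ (φ̄ ⋆ A)(x)`. [folklore] -/
theorem quadratic_lower_moll (φ : ContDiffBump (0 : Fin n → ℝ)) (hφ : φ.rOut ≤ 1)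
    {A : (Fin n → ℝ) → ℝ} (hA : Continuous A) {C κ : ℝ} (hC : 0 ≤ C) (hκ : 0 ≤ κ)
    (hlb : ∀ x, -C * (1 + ‖x‖) + κ * ‖x‖ ^ 2 ≤ A x) (x : Fin n → ℝ) :
    -(2 * C + 2 * κ) * (1 + ‖x‖) + κ * ‖x‖ ^ 2 ≤ (φ.normed volume ⋆[lsmul ℝ ℝ, volume] A) x := by
  refine le_moll_of_forall_ball φ hA x fun t ht => ?_
  have ht1 : ‖t‖ ≤ 1 := (ht.le).trans hφ
  have h1 := hlb (x - t)
  have h2 : ‖x - t‖ ≤ ‖x‖ + 1 := (norm_sub_le x t).trans (by linarith)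
  have h3 : ‖x‖ - 1 ≤ ‖x - t‖ := by
    have := norm_sub_norm_le x t
    have h' : ‖x‖ - ‖t‖ ≤ ‖x - t‖ := by
      have := abs_norm_sub_norm_le x t
      rw [abs_le] at this; linarith [this.2, norm_sub_norm_le x t, le_abs_self (‖x‖ - ‖t‖)]
    linarith
  have h4 : ‖x‖ ^ 2 - 2 * ‖x‖ ≤ ‖x - t‖ ^ 2 := by
    rcases le_or_gt 1 ‖x‖ with hx | hx
    · nlinarith [h3, norm_nonneg (x - t)]
    · nlinarith [norm_nonneg (x - t), norm_nonneg x, sq_nonneg ‖x - t‖]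
  nlinarith [h1, h2, h4, norm_nonneg x]

/-- **POINTWISE CONVERGENCE** of the mollifications along bumps with `rOut → 0`. [folklore] -/
theorem tendsto_moll (φ : ℕ → ContDiffBump (0 : Fin n → ℝ)) (hφ : Tendsto (fun k => (φ k).rOut) atTop (𝓝 0))
    {A : (Fin n → ℝ) → ℝ} (hA : Continuous A) (x : Fin n → ℝ) :
    Tendsto (fun k => ((φ k).normed volume ⋆[lsmul ℝ ℝ, volume] A) x) atTop (𝓝 (A x)) :=
  ContDiffBump.convolution_tendsto_right_of_continuous hφ hA x

/-- **CONVERGENCE OF GIBBS MOMENTS under mollification** (dominated convergence with the uniform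
Gaussian majorant): for continuous `w` with `|w| ≤ D(1+‖x‖)^k`, `k ≤ 8`,
`∫ w e^{−A_j} → ∫ w e^{−A}`. [folklore] -/
theorem tendsto_integral_moll (φ : ℕ → ContDiffBump (0 : Fin n → ℝ))
    (hφ : Tendsto (fun k => (φ k).rOut) atTop (𝓝 0)) (hφ1 : ∀ k, (φ k).rOut ≤ 1)
    {A w : (Fin n → ℝ) → ℝ} (hA : Continuous A) (hw : Continuous w) {C κ D : ℝ} {k : ℕ}
    (hC : 0 ≤ C) (hκ : 0 < κ) (hk : k ≤ 8)
    (hlb : ∀ x, -C * (1 + ‖x‖) + κ * ‖x‖ ^ 2 ≤ A x) (hwb : ∀ x, |w x| ≤ D * (1 + ‖x‖) ^ k) :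
    Tendsto (fun j => ∫ x, w x * exp (-((φ j).normed volume ⋆[lsmul ℝ ℝ, volume] A) x)) atTop
      (𝓝 (∫ x, w x * exp (-A x))) := by
  -- the dominating function `|w| e^{−L}` with `L` the uniform quadratic lower bound
  set L : (Fin n → ℝ) → ℝ := fun x => -(2 * C + 2 * κ) * (1 + ‖x‖) + κ * ‖x‖ ^ 2 with hL
  have hLc : Continuous L := ((continuous_const.mul (continuous_const.add continuous_norm)).add
    (continuous_const.mul (continuous_norm.pow 2)))
  have hbound : Integrable fun x => |w x| * exp (-L x) :=
    integrable_mul_exp_neg_of_growth hLc hw.abs hκ hk (C := 2 * C + 2 * κ) (fun x => le_rfl)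
      (fun x => by rw [abs_abs]; exact hwb x)
  refine tendsto_integral_of_dominated_convergence (fun x => |w x| * exp (-L x)) (fun j => ?_) hbound
    (fun j => ae_of_all _ fun x => ?_) (ae_of_all _ fun x => ?_)
  · exact (hw.mul (continuous_exp.comp (contDiff_moll (φ j) hA).continuous.neg)).aestronglyMeasurable
  · rw [norm_mul, Real.norm_eq_abs, Real.norm_eq_abs, abs_of_pos (exp_pos _)]
    refine mul_le_mul_of_nonneg_left (exp_le_exp.mpr (neg_le_neg ?_)) (abs_nonneg _)
    exact quadratic_lower_moll (φ j) (hφ1 j) hA hC hκ.le hlb x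
  · exact ((continuous_exp.tendsto _).comp ((tendsto_moll φ hφ hA x).neg)).const_mul _


/-- Shift invariance of the variance functional: `Var(F − c) = Var(F)` in ratio form. [folklore] -/
theorem var_ratio_shift {Z I1 I2 : ℝ} (hZ : Z ≠ 0) (c : ℝ) :
    (I2 - 2 * c * I1 + c ^ 2 * Z) / Z - (I1 - c * Z) / Z * ((I1 - c * Z) / Z) = I2 / Z - I1 / Z * (I1 / Z) := by
  field_simp
  ring

open Summit.QuantumFields.YangMills.Cruxes.TransportCovarianceTransfer in
/-- **THE VARIANCE FLOOR IN THE WHITENED FRAME FOR A CONTINUOUS POTENTIAL** (`C = 2`): for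
`0 ≤ δ < 1`, `H` symmetric, `b`, and `A` CONTINUOUS with the Euclidean second-difference sandwich and
the centring `∫ x_i e^{−A} = 0`,
`(1 − 2δ)(2 tr H² + |b|²) ≤ gE(q²) − gE(q)²`.
Proof: mollify `A` by normed bumps (`sandwich_moll`: same sandwich; `contDiff_moll`: smooth), recentre
by the mean `m_k` (a translation: sandwich kept, centring restored), apply the smooth floor
`floorWhitened_of_contDiff` to the observable `(H, b + 2Hm_k)` — whose variance under the recentred
weight is the variance of `q` under `e^{−A_k}` — and let `k → ∞` (`tendsto_integral_moll`, `m_k → 0`).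
[folklore] -/
theorem floorWhitened {δ : ℝ} (hδ : 0 ≤ δ) (hδ1 : δ < 1)
    (H : Matrix (Fin n) (Fin n) ℝ) (b : Fin n → ℝ) {A : (Fin n → ℝ) → ℝ} (hH : H.IsSymm)
    (hA : Continuous A)
    (hsw : ∀ x h : Fin n → ℝ, (1 - δ) * (h ⬝ᵥ h) ≤ A (x + h) + A (x - h) - 2 * A x ∧
      A (x + h) + A (x - h) - 2 * A x ≤ (1 + δ) * (h ⬝ᵥ h))
    (hcent : ∀ i : Fin n, ∫ x, x i * exp (-A x) = 0) :
    (1 - 2 * δ) * (2 * (H * H).trace + b ⬝ᵥ b) ≤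
      (∫ x, (x ⬝ᵥ H.mulVec x + b ⬝ᵥ x) * (x ⬝ᵥ H.mulVec x + b ⬝ᵥ x) * exp (-A x)) / (∫ x, exp (-A x)) -
        (∫ x, (x ⬝ᵥ H.mulVec x + b ⬝ᵥ x) * exp (-A x)) / (∫ x, exp (-A x)) *
          ((∫ x, (x ⬝ᵥ H.mulVec x + b ⬝ᵥ x) * exp (-A x)) / (∫ x, exp (-A x))) := by
  obtain ⟨C₀, κ, hC₀, hκ, hlb⟩ := exists_quadratic_lower_of_sandwich hA hδ1 hsw
  -- the observable and its growth
  set q : (Fin n → ℝ) → ℝ := fun x => x ⬝ᵥ H.mulVec x + b ⬝ᵥ x with hqdef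
  have hqc : Continuous q := (contDiff_quadObs H b).continuous
  obtain ⟨Dq, hDq0, hDq⟩ := exists_abs_quad_le H b
  have hqb : ∀ x, |q x| ≤ Dq * (1 + ‖x‖) ^ 2 := fun x => by
    refine (hDq x).trans (mul_le_mul_of_nonneg_left ?_ hDq0)
    nlinarith [norm_nonneg x]
  have hqqb := abs_mul_le_growth hqb hqb
  -- bumps with support radius `1/(k+1)`
  have hr : ∀ k : ℕ, (0:ℝ) < 1 / (2 * ((k:ℝ) + 1)) := fun k => by positivity
  have hr' : ∀ k : ℕ, 1 / (2 * ((k:ℝ) + 1)) < 1 / ((k:ℝ) + 1) := fun k =>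
    one_div_lt_one_div_of_lt (by positivity) (by linarith [(Nat.cast_nonneg k : (0:ℝ) ≤ k)])
  set φ : ℕ → ContDiffBump (0 : Fin n → ℝ) := fun k => ⟨1 / (2 * ((k:ℝ) + 1)), 1 / ((k:ℝ) + 1), hr k, hr' k⟩
    with hφdef
  have hφout : ∀ k, (φ k).rOut = 1 / ((k:ℝ) + 1) := fun k => rfl
  have hφ : Tendsto (fun k => (φ k).rOut) atTop (𝓝 0) := by
    simp only [hφout]; exact tendsto_one_div_add_atTop_nhds_zero_nat
  have hφ1 : ∀ k, (φ k).rOut ≤ 1 := fun k => by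
    rw [hφout, div_le_one (by positivity)]; linarith [(Nat.cast_nonneg k : (0:ℝ) ≤ k)]
  -- the mollified potentials
  set Am : ℕ → (Fin n → ℝ) → ℝ := fun k => (φ k).normed volume ⋆[lsmul ℝ ℝ, volume] A with hAmdef
  have hAm2 : ∀ k, ContDiff ℝ 2 (Am k) := fun k => contDiff_moll (φ k) hA
  have hAmc : ∀ k, Continuous (Am k) := fun k => (hAm2 k).continuous
  have hswm : ∀ k (x h : Fin n → ℝ), (1 - δ) * (h ⬝ᵥ h) ≤ Am k (x + h) + Am k (x - h) - 2 * Am k x ∧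
      Am k (x + h) + Am k (x - h) - 2 * Am k x ≤ (1 + δ) * (h ⬝ᵥ h) := fun k x h =>
    sandwich_moll (φ k) hA hsw x h
  have hlbm : ∀ k x, -(2 * C₀ + 2 * κ) * (1 + ‖x‖) + κ * ‖x‖ ^ 2 ≤ Am k x := fun k x =>
    quadratic_lower_moll (φ k) (hφ1 k) hA hC₀ hκ.le hlb x
  -- moments under `e^{−A_k}` and their limits
  have hlim : ∀ {w : (Fin n → ℝ) → ℝ} {D : ℝ} {j : ℕ}, Continuous w → j ≤ 8 →
      (∀ x, |w x| ≤ D * (1 + ‖x‖) ^ j) →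
      Tendsto (fun k => ∫ x, w x * exp (-Am k x)) atTop (𝓝 (∫ x, w x * exp (-A x))) :=
    fun hw hj hwb => tendsto_integral_moll φ hφ hφ1 hA hw hC₀ hκ hj hlb hwb
  have hZlim : Tendsto (fun k => ∫ x, exp (-Am k x)) atTop (𝓝 (∫ x, exp (-A x))) := by
    have := hlim (w := fun _ => (1:ℝ)) (D := 1) (j := 0) continuous_const (by norm_num) (fun x => by simp)
    simpa using this
  have hMlim : ∀ i : Fin n, Tendsto (fun k => ∫ x, x i * exp (-Am k x)) atTop (𝓝 0) := fun i => by
    have := hlim (w := fun x => x i) (D := 1) (j := 1) (continuous_apply i) (by norm_num) (fun x => by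
      rw [pow_one]
      have : |x i| ≤ ‖x‖ := by simpa [Real.norm_eq_abs] using norm_le_pi_norm x i
      linarith [norm_nonneg x])
    rwa [hcent i] at this
  have hIqlim : Tendsto (fun k => ∫ x, q x * exp (-Am k x)) atTop (𝓝 (∫ x, q x * exp (-A x))) :=
    hlim hqc (by norm_num) hqb
  have hIqqlim : Tendsto (fun k => ∫ x, q x * q x * exp (-Am k x)) atTop
      (𝓝 (∫ x, q x * q x * exp (-A x))) :=
    hlim (hqc.mul hqc) (by norm_num) hqqb
  -- positivity of the partition functions
  have hZ : 0 < ∫ x, exp (-A x) := by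
    have := integrable_mul_exp_neg_of_growth hA continuous_const hκ (by norm_num : 0 ≤ 8) hlb
      (w := fun _ => (1:ℝ)) (D := 1) (fun x => by simp)
    exact integral_exp_pos (by simpa using this)
  have hZk : ∀ k, 0 < ∫ x, exp (-Am k x) := fun k => by
    have := integrable_mul_exp_neg_of_growth (hAmc k) continuous_const hκ (by norm_num : 0 ≤ 8) (hlbm k)
      (w := fun _ => (1:ℝ)) (D := 1) (fun x => by simp)
    exact integral_exp_pos (by simpa using this)
  -- the means and the recentred potentials
  set m : ℕ → (Fin n → ℝ) := fun k i => (∫ x, x i * exp (-Am k x)) / ∫ x, exp (-Am k x) with hmdef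
  have hmlim : Tendsto m atTop (𝓝 0) := by
    rw [tendsto_pi_nhds]
    intro i
    have h := (hMlim i).div hZlim hZ.ne'
    rw [zero_div] at h
    exact h
  set At : ℕ → (Fin n → ℝ) → ℝ := fun k y => Am k (y + m k) with hAtdef
  have hAt2 : ∀ k, ContDiff ℝ 2 (At k) := fun k => (hAm2 k).comp (contDiff_id.add contDiff_const)
  have hswt : ∀ k (y h : Fin n → ℝ), (1 - δ) * (h ⬝ᵥ h) ≤ At k (y + h) + At k (y - h) - 2 * At k y ∧
      At k (y + h) + At k (y - h) - 2 * At k y ≤ (1 + δ) * (h ⬝ᵥ h) := by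
    intro k y h
    have := hswm k (y + m k) h
    simp only [hAtdef]
    rwa [show y + h + m k = y + m k + h by abel, show y - h + m k = y + m k - h by abel]
  have hcentt : ∀ k (i : Fin n), ∫ y, y i * exp (-At k y) = 0 := by
    intro k i
    have hT := integral_add_right_eq_self (μ := (volume : Measure (Fin n → ℝ)))
      (fun x => (x i - m k i) * exp (-Am k x)) (m k)
    simp only [Pi.add_apply, add_sub_cancel_right] at hT
    -- `hT : ∫ y, y i * exp(-Am k (y + m k)) = ∫ x, (x i - m k i) * exp(-Am k x)`
    simp only [hAtdef]
    rw [hT]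
    have hI1 : Integrable fun x => x i * exp (-Am k x) :=
      integrable_mul_exp_neg_of_growth (hAmc k) (continuous_apply i) hκ (by norm_num : 1 ≤ 8) (hlbm k)
        (D := 1) (fun x => by
          rw [pow_one]
          have : |x i| ≤ ‖x‖ := by simpa [Real.norm_eq_abs] using norm_le_pi_norm x i
          linarith [norm_nonneg x])
    have hI0 : Integrable fun x => exp (-Am k x) := by
      have := integrable_mul_exp_neg_of_growth (hAmc k) continuous_const hκ (by norm_num : 0 ≤ 8) (hlbm k)
        (w := fun _ => (1:ℝ)) (D := 1) (fun x => by simp)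
      simpa using this
    have e : (fun x => (x i - m k i) * exp (-Am k x)) = fun x => x i * exp (-Am k x) - m k i * exp (-Am k x) := by
      funext x; ring
    rw [e, integral_sub hI1 (hI0.const_mul _), integral_const_mul,
      show m k i = (∫ x, x i * exp (-Am k x)) / ∫ x, exp (-Am k x) from rfl,
      div_mul_cancel₀ _ (hZk k).ne', sub_self]
  -- the smooth floor for the recentred potentials, observable `(H, b + 2Hm_k)`
  have hfloor := fun k => floorWhitened_of_contDiff hδ hδ1 H (b + (2:ℝ) • H.mulVec (m k)) hH (hAt2 k)
    (hswt k) (hcentt k)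
  -- identify the variance under the recentred weight with the variance of `q` under `e^{−A_k}`
  have hident : ∀ k,
      (∫ y, (y ⬝ᵥ H.mulVec y + (b + (2:ℝ) • H.mulVec (m k)) ⬝ᵥ y) *
          (y ⬝ᵥ H.mulVec y + (b + (2:ℝ) • H.mulVec (m k)) ⬝ᵥ y) * exp (-At k y)) / (∫ y, exp (-At k y)) -
        (∫ y, (y ⬝ᵥ H.mulVec y + (b + (2:ℝ) • H.mulVec (m k)) ⬝ᵥ y) * exp (-At k y)) / (∫ y, exp (-At k y)) *
          ((∫ y, (y ⬝ᵥ H.mulVec y + (b + (2:ℝ) • H.mulVec (m k)) ⬝ᵥ y) * exp (-At k y)) / (∫ y, exp (-At k y)))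
      = (∫ x, q x * q x * exp (-Am k x)) / (∫ x, exp (-Am k x)) -
        (∫ x, q x * exp (-Am k x)) / (∫ x, exp (-Am k x)) *
          ((∫ x, q x * exp (-Am k x)) / (∫ x, exp (-Am k x))) := by
    intro k
    set c : ℝ := b ⬝ᵥ m k + H.mulVec (m k) ⬝ᵥ m k with hc
    -- the shifted observable is `q(· + m) − c`... precisely `q_k(y) = q(y + m_k) − c`
    have hqk : ∀ y, y ⬝ᵥ H.mulVec y + (b + (2:ℝ) • H.mulVec (m k)) ⬝ᵥ y = q (y + m k) - c := by
      intro y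
      simp only [hqdef, hc, Matrix.mulVec_add, add_dotProduct, dotProduct_add, smul_dotProduct, smul_eq_mul]
      have e1 : y ⬝ᵥ H.mulVec (m k) = H.mulVec (m k) ⬝ᵥ y := by
        rw [dotProduct_mulVec_of_isSymm hH y (m k), dotProduct_comm]
        rw [← dotProduct_mulVec_of_isSymm hH (m k) y]
      have e2 : m k ⬝ᵥ H.mulVec y = H.mulVec (m k) ⬝ᵥ y := dotProduct_mulVec_of_isSymm hH (m k) y
      have e3 : b ⬝ᵥ m k = m k ⬝ᵥ b := dotProduct_comm _ _
      have e4 : m k ⬝ᵥ H.mulVec (m k) = H.mulVec (m k) ⬝ᵥ m k := dotProduct_mulVec_of_isSymm hH (m k) (m k)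
      rw [e1, e2, e4]
      ring
    -- translate the three integrals
    have T0 : ∫ y, exp (-At k y) = ∫ x, exp (-Am k x) :=
      integral_add_right_eq_self (μ := (volume : Measure (Fin n → ℝ))) (fun x => exp (-Am k x)) (m k)
    have T1 : ∫ y, (y ⬝ᵥ H.mulVec y + (b + (2:ℝ) • H.mulVec (m k)) ⬝ᵥ y) * exp (-At k y) =
        ∫ x, (q x - c) * exp (-Am k x) := by
      simp only [hqk, hAtdef]
      exact integral_add_right_eq_self (μ := (volume : Measure (Fin n → ℝ)))
        (fun x => (q x - c) * exp (-Am k x)) (m k)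
    have T2 : ∫ y, (y ⬝ᵥ H.mulVec y + (b + (2:ℝ) • H.mulVec (m k)) ⬝ᵥ y) *
        (y ⬝ᵥ H.mulVec y + (b + (2:ℝ) • H.mulVec (m k)) ⬝ᵥ y) * exp (-At k y) =
        ∫ x, (q x - c) * (q x - c) * exp (-Am k x) := by
      simp only [hqk, hAtdef]
      exact integral_add_right_eq_self (μ := (volume : Measure (Fin n → ℝ)))
        (fun x => (q x - c) * (q x - c) * exp (-Am k x)) (m k)
    rw [T0, T1, T2]
    -- expand the shifted moments
    have hI0 : Integrable fun x => exp (-Am k x) := by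
      have := integrable_mul_exp_neg_of_growth (hAmc k) continuous_const hκ (by norm_num : 0 ≤ 8) (hlbm k)
        (w := fun _ => (1:ℝ)) (D := 1) (fun x => by simp)
      simpa using this
    have hI1 : Integrable fun x => q x * exp (-Am k x) :=
      integrable_mul_exp_neg_of_growth (hAmc k) hqc hκ (by norm_num) (hlbm k) hqb
    have hI2 : Integrable fun x => q x * q x * exp (-Am k x) :=
      integrable_mul_exp_neg_of_growth (hAmc k) (hqc.mul hqc) hκ (by norm_num) (hlbm k) hqqb
    have e1 : (fun x => (q x - c) * exp (-Am k x)) = fun x => q x * exp (-Am k x) - c * exp (-Am k x) := by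
      funext x; ring
    have e2 : (fun x => (q x - c) * (q x - c) * exp (-Am k x)) =
        fun x => q x * q x * exp (-Am k x) - (2 * c) * (q x * exp (-Am k x)) + c ^ 2 * exp (-Am k x) := by
      funext x; ring
    have hI12 : Integrable fun x => q x * q x * exp (-Am k x) - (2 * c) * (q x * exp (-Am k x)) :=
      hI2.sub (hI1.const_mul _)
    rw [e1, e2, integral_sub hI1 (hI0.const_mul _), integral_const_mul,
      integral_add hI12 (hI0.const_mul _), integral_sub hI2 (hI1.const_mul _), integral_const_mul,
      integral_const_mul]
    rw [show (2 * c) * ∫ x, q x * exp (-Am k x) = 2 * c * ∫ x, q x * exp (-Am k x) from rfl]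
    exact var_ratio_shift (hZk k).ne' c
  -- the floor for each `k`, in terms of `q` and `A_k`
  have hk : ∀ k, (1 - 2 * δ) * (2 * (H * H).trace + (b + (2:ℝ) • H.mulVec (m k)) ⬝ᵥ (b + (2:ℝ) • H.mulVec (m k)))
      ≤ (∫ x, q x * q x * exp (-Am k x)) / (∫ x, exp (-Am k x)) -
        (∫ x, q x * exp (-Am k x)) / (∫ x, exp (-Am k x)) *
          ((∫ x, q x * exp (-Am k x)) / (∫ x, exp (-Am k x))) := fun k => by
    have h := hfloor k
    rw [hident k] at h
    exact h
  -- pass to the limit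
  have hL : Tendsto (fun k => (1 - 2 * δ) * (2 * (H * H).trace +
      (b + (2:ℝ) • H.mulVec (m k)) ⬝ᵥ (b + (2:ℝ) • H.mulVec (m k)))) atTop
      (𝓝 ((1 - 2 * δ) * (2 * (H * H).trace + b ⬝ᵥ b))) := by
    have hcont : Continuous fun v : Fin n → ℝ => (1 - 2 * δ) * (2 * (H * H).trace +
        (b + (2:ℝ) • H.mulVec v) ⬝ᵥ (b + (2:ℝ) • H.mulVec v)) := by
      have h1 : Continuous fun v : Fin n → ℝ => H.mulVec v :=
        (Matrix.mulVecLin H).toContinuousLinearMap.continuous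
      have hv : Continuous fun v : Fin n → ℝ => b + (2:ℝ) • H.mulVec v :=
        continuous_const.add (h1.const_smul (2:ℝ))
      exact continuous_const.mul (continuous_const.add (hv.dotProduct hv))
    have := (hcont.tendsto 0).comp hmlim
    simp only [Matrix.mulVec_zero, smul_zero, add_zero] at this
    exact this
  have hR : Tendsto (fun k => (∫ x, q x * q x * exp (-Am k x)) / (∫ x, exp (-Am k x)) -
      (∫ x, q x * exp (-Am k x)) / (∫ x, exp (-Am k x)) *
        ((∫ x, q x * exp (-Am k x)) / (∫ x, exp (-Am k x)))) atTop
      (𝓝 ((∫ x, q x * q x * exp (-A x)) / (∫ x, exp (-A x)) -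
        (∫ x, q x * exp (-A x)) / (∫ x, exp (-A x)) * ((∫ x, q x * exp (-A x)) / (∫ x, exp (-A x))))) :=
    (hIqqlim.div hZlim hZ.ne').sub ((hIqlim.div hZlim hZ.ne').mul (hIqlim.div hZlim hZ.ne'))
  exact le_of_tendsto_of_tendsto' hL hR hk

end Summit.QuantumFields.YangMills.Theorems.SandwichVariancePinching

end
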